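import Mathlib
import Summits.MatrixMultiplication.MatrixMultiplication.Theses.ShapeSubmodularity
import Summits.MatrixMultiplication.MatrixMultiplication.Theorems.ShapeSubmodularityShapeSubmodularCoreReduction
import Summits.MatrixMultiplication.MatrixMultiplication.Theorems.ShapeSubmodularityShapeSubmodularStubCellOfSandwich
import Summits.MatrixMultiplication.MatrixMultiplication.Theorems.ShapeSubmodularityShapeSubmodularStubSandwichRay11
import Summits.MatrixMultiplication.MatrixMultiplication.Theorems.ShapeSubmodularityShapeSubmodularStubCellOfRelSandwich
import Literature.Computability.AlgebraicComplexity.RectangularExponentAlpha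

/-!
# MatrixMultiplication / ShapeSubmodularity — `ShapeSubmodular` reduces to its certificate-free core

Crux `ShapeSubmodular` (stmt-MatrixMultiplication-15622, route `ShapeSubmodularity`): the rectangular exponent
`(a,b,c) ↦ ω(a,b,c)` is submodular on `ℕ³`, in RANK FORM (`R(a,b,c) := n ↦ tensorRank (matMulTensor ℂ (n^a) (n^b) (n^c))`,
admissible `β` ⇔ `R = O(n^β)`).  `…CoreReduction.lean` (cycle c2) proved `ShapeSubmodular ↔` the unit exchange law of the
coordinate pair (1,2) on the FAT CORE `α·median < min` (`α = dualExponentAlpha ℂ`).  This file (cycle c3) sharpens the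
right-hand side once more, using the landed RELATIVE SANDWICH `stub_cellOfRelSandwich` (p156081, over
`stub_decompositionBound` p155759): a unit cell with meet `M = (a,b,c)`, `P = (a+1,b,c)`, `Q = (a,b+1,c)`,
`J = (a+1,b+1,c)` holds as soon as it carries a CERTIFICATE — for every `δ > 0`, naturals `k ≥ 1`, `p₁…p₈` and free
formats `F₁, F₂` with admissible `u₁, u₂` such that `k·M ≤ p₁P + p₂σP + p₃Q + p₄σQ + F₁`, `k·J ≤ p₅P + p₆σP + p₇Q + p₈σQ + F₂`
(`σ` swaps the last two coordinates), `ΣP-weights ≤ k`, `ΣQ-weights ≤ k`, and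
`u₁ + u₂ + (ΣP-weights)·L(P) + (ΣQ-weights)·L(Q) ≤ k·(L(P)+L(Q)) + δ` (`L` = flattening exponent).

* `relSandwich_of_sandwich` — the modular sandwich of `stub_cellOfSandwich` (p153815) is the certificate `k = 1`,
  no weights, `F₁ = M`, `F₂ = J`; so the landed rays `(1,1,c ≥ 2)` (`stub_sandwichRay11`, ADVXXZ2025 table) and
  `(2,2,c ≥ 9)` (`stub_sandwichRay22`, VXXZ2024) are certified cells: `cell_one_one_of_advxxz2025`.
* `unitExchange_of_coreNoCert` — the unit exchange law on ALL cells follows from the law on the core cells WITHOUT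
  certificate (boundary: `stub_unitExchangeBoundary`; flat meets: `unitExchange_of_flatMeet`; certified cells:
  `stub_cellOfRelSandwich`).
* `ShapeSubmodular_iff_coreNoCert` — **the crux is equivalent to the unit exchange law on the certificate-free fat
  core.**  By LP duality (evidence `census-c3.md` on the item) a cell HAS a certificate iff it follows from symmetry,
  sublinearity, monotonicity, the Lipschitz/blocking bound, flattening and the admissible bounds fed in as `u₁, u₂`; the
  census (exact, `a,b,c ≤ 12`) finds certificates exactly for the flat, the sandwichable and the flat-neighbour
  `(a,3a,c ≥ 3a+1)` cells, and an explicit violating model of all those facts for each of the other 705 core cells —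
  every cube `(k,k,k)` among them (room `k/(3k+1)`).  What `ShapeSubmodular_iff_coreNoCert` leaves open is therefore
  the open problem proper (first instance `ω(2,2,1) + ω ≤ 2·ω(1,1,2)`).
-/

set_option linter.dupNamespace false
-- (single-conjunct summit: the namespace repeats `MatrixMultiplication`)

namespace Summit.MatrixMultiplication.MatrixMultiplication.Theorems.ShapeSubmodular

open Summit.MatrixMultiplication.MatrixMultiplication.Theses.ShapeSubmodularity
open Literature.Computability.AlgebraicComplexity
open Filter Asymptotics

/-! ## Sandwichable cells are certified -/

/-- **A sandwichable cell carries a relative-sandwich certificate**: `k = 1`, no `P`/`Q`-weights, `F₁ = M`, `F₂ = J`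
(the hypothesis of `stub_cellOfSandwich` implies that of `stub_cellOfRelSandwich`). [folklore] -/
theorem relSandwich_of_sandwich (a b c : ℕ)
    (hsw : (∃ u u' : ℝ,
        u + u' ≤ ((max (a + 1 + b) (max (b + c) (a + 1 + c)) + max (a + (b + 1)) (max (b + 1 + c) (a + c)) : ℕ) : ℝ) ∧
        (fun n : ℕ => (tensorRank (matMulTensor ℂ (n ^ (a + 1)) (n ^ (b + 1)) (n ^ c)) : ℝ)) =O[atTop] (fun n : ℕ => (n : ℝ) ^ u) ∧
        (fun n : ℕ => (tensorRank (matMulTensor ℂ (n ^ a) (n ^ b) (n ^ c)) : ℝ)) =O[atTop] (fun n : ℕ => (n : ℝ) ^ u'))) :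
    (∀ δ : ℝ, 0 < δ → ∃ k p₁ p₂ p₃ p₄ p₅ p₆ p₇ p₈ : ℕ, ∃ f₁ g₁ h₁ f₂ g₂ h₂ : ℕ, ∃ u₁ u₂ : ℝ,
        1 ≤ k ∧ p₁ + p₂ + p₅ + p₆ ≤ k ∧ p₃ + p₄ + p₇ + p₈ ≤ k ∧
        k * a ≤ (p₁ + p₂) * (a + 1) + (p₃ + p₄) * a + f₁ ∧
        k * b ≤ p₁ * b + p₂ * c + p₃ * (b + 1) + p₄ * c + g₁ ∧
        k * c ≤ p₁ * c + p₂ * b + p₃ * c + p₄ * (b + 1) + h₁ ∧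
        k * (a + 1) ≤ (p₅ + p₆) * (a + 1) + (p₇ + p₈) * a + f₂ ∧
        k * (b + 1) ≤ p₅ * b + p₆ * c + p₇ * (b + 1) + p₈ * c + g₂ ∧
        k * c ≤ p₅ * c + p₆ * b + p₇ * c + p₈ * (b + 1) + h₂ ∧
        (fun n : ℕ => (tensorRank (matMulTensor ℂ (n ^ f₁) (n ^ g₁) (n ^ h₁)) : ℝ)) =O[atTop]
          (fun n : ℕ => (n : ℝ) ^ u₁) ∧
        (fun n : ℕ => (tensorRank (matMulTensor ℂ (n ^ f₂) (n ^ g₂) (n ^ h₂)) : ℝ)) =O[atTop]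
          (fun n : ℕ => (n : ℝ) ^ u₂) ∧
        u₁ + u₂ + (((p₁ + p₂ + p₅ + p₆) * (max (a + 1 + b) (max (b + c) (a + 1 + c))) +
            (p₃ + p₄ + p₇ + p₈) * (max (a + (b + 1)) (max (b + 1 + c) (a + c))) : ℕ) : ℝ)
          ≤ ((k * (max (a + 1 + b) (max (b + c) (a + 1 + c)) + max (a + (b + 1)) (max (b + 1 + c) (a + c))) : ℕ) : ℝ)
            + δ) := by
  obtain ⟨u, u', hsum, hu, hu'⟩ := hsw
  intro δ hδ
  refine ⟨1, 0, 0, 0, 0, 0, 0, 0, 0, a, b, c, a + 1, b + 1, c, u', u, le_rfl, by omega, by omega,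
    by omega, by omega, by omega, by omega, by omega, by omega, hu', hu, ?_⟩
  push_cast at hsum ⊢
  nlinarith [hsum, hδ]

/-- **The first ray of the fat core is certified** (conditional on the named fact `advxxz2025_omegaRect_table`):
for every `c ≥ 2` the cell with meet `(1,1,c)` — `ω(2,2,c) + ω(1,1,c) ≤ ω(2,1,c) + ω(1,2,c)` — holds, by
`stub_sandwichRay11` (`2·2.371339 + 3.250035 ≤ 8`) and `stub_cellOfSandwich`.
[cite: AlmanDuanVassilevskaWilliamsXuXuZhou2025, §1 Table 1] -/
theorem cell_one_one_of_advxxz2025 (hT : advxxz2025_omegaRect_table) (c : ℕ) (hc : 2 ≤ c) :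
    ∀ β β' : ℝ,
      (fun n : ℕ => (tensorRank (matMulTensor ℂ (n ^ (1 + 1)) (n ^ 1) (n ^ c)) : ℝ)) =O[atTop] (fun n : ℕ => (n : ℝ) ^ β) →
      (fun n : ℕ => (tensorRank (matMulTensor ℂ (n ^ 1) (n ^ (1 + 1)) (n ^ c)) : ℝ)) =O[atTop] (fun n : ℕ => (n : ℝ) ^ β') →
      ∀ ε : ℝ, 0 < ε → ∃ γ γ' : ℝ, γ + γ' ≤ β + β' + ε ∧
        (fun n : ℕ => (tensorRank (matMulTensor ℂ (n ^ (1 + 1)) (n ^ (1 + 1)) (n ^ c)) : ℝ)) =O[atTop] (fun n : ℕ => (n : ℝ) ^ γ) ∧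
        (fun n : ℕ => (tensorRank (matMulTensor ℂ (n ^ 1) (n ^ 1) (n ^ c)) : ℝ)) =O[atTop] (fun n : ℕ => (n : ℝ) ^ γ') := by
  refine stub_cellOfSandwich 1 1 c ?_
  obtain ⟨u, u', hsum, hu, hu'⟩ := stub_sandwichRay11 hT c hc
  refine ⟨u, u', ?_, ?_, hu'⟩
  · have hL : ((max (1 + 1 + 1) (max (1 + c) (1 + 1 + c)) + max (1 + (1 + 1)) (max (1 + 1 + c) (1 + c)) : ℕ) : ℝ)
        = 2 * ((c : ℝ) + 2) := by
      have h : (max (1 + 1 + 1) (max (1 + c) (1 + 1 + c)) + max (1 + (1 + 1)) (max (1 + 1 + c) (1 + c)) : ℕ)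
          = 2 * (c + 2) := by omega
      rw [h]; push_cast; ring
    rw [hL]; exact hsum
  · simpa using hu

/-! ## All cells from the certificate-free core -/

/-- **All cells from the certificate-free core**: if the unit exchange law holds at every cell whose meet `(a,b,c)`
(`a, b, c ≥ 1`) lies in the fat core (`α·median < min`) and carries NO relative-sandwich certificate, then it holds at
every cell of `ℕ³`: boundary cells by `stub_unitExchangeBoundary`, flat meets by `unitExchange_of_flatMeet`,
certified cells by `stub_cellOfRelSandwich`. [folklore] -/
theorem unitExchange_of_coreNoCert
    (hcore : ∀ a b c : ℕ, 1 ≤ a → 1 ≤ b → 1 ≤ c →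
      dualExponentAlpha ℂ * ((max (min a b) (min (max a b) c) : ℕ) : ℝ) < ((min a (min b c) : ℕ) : ℝ) →
      ¬ (∀ δ : ℝ, 0 < δ → ∃ k p₁ p₂ p₃ p₄ p₅ p₆ p₇ p₈ : ℕ, ∃ f₁ g₁ h₁ f₂ g₂ h₂ : ℕ, ∃ u₁ u₂ : ℝ,
        1 ≤ k ∧ p₁ + p₂ + p₅ + p₆ ≤ k ∧ p₃ + p₄ + p₇ + p₈ ≤ k ∧
        k * a ≤ (p₁ + p₂) * (a + 1) + (p₃ + p₄) * a + f₁ ∧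
        k * b ≤ p₁ * b + p₂ * c + p₃ * (b + 1) + p₄ * c + g₁ ∧
        k * c ≤ p₁ * c + p₂ * b + p₃ * c + p₄ * (b + 1) + h₁ ∧
        k * (a + 1) ≤ (p₅ + p₆) * (a + 1) + (p₇ + p₈) * a + f₂ ∧
        k * (b + 1) ≤ p₅ * b + p₆ * c + p₇ * (b + 1) + p₈ * c + g₂ ∧
        k * c ≤ p₅ * c + p₆ * b + p₇ * c + p₈ * (b + 1) + h₂ ∧
        (fun n : ℕ => (tensorRank (matMulTensor ℂ (n ^ f₁) (n ^ g₁) (n ^ h₁)) : ℝ)) =O[atTop]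
          (fun n : ℕ => (n : ℝ) ^ u₁) ∧
        (fun n : ℕ => (tensorRank (matMulTensor ℂ (n ^ f₂) (n ^ g₂) (n ^ h₂)) : ℝ)) =O[atTop]
          (fun n : ℕ => (n : ℝ) ^ u₂) ∧
        u₁ + u₂ + (((p₁ + p₂ + p₅ + p₆) * (max (a + 1 + b) (max (b + c) (a + 1 + c))) +
            (p₃ + p₄ + p₇ + p₈) * (max (a + (b + 1)) (max (b + 1 + c) (a + c))) : ℕ) : ℝ)
          ≤ ((k * (max (a + 1 + b) (max (b + c) (a + 1 + c)) + max (a + (b + 1)) (max (b + 1 + c) (a + c))) : ℕ) : ℝ)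
            + δ) →
      ∀ β β' : ℝ,
      (fun n : ℕ => (tensorRank (matMulTensor ℂ (n ^ (a + 1)) (n ^ b) (n ^ c)) : ℝ)) =O[atTop] (fun n : ℕ => (n : ℝ) ^ β) →
      (fun n : ℕ => (tensorRank (matMulTensor ℂ (n ^ a) (n ^ (b + 1)) (n ^ c)) : ℝ)) =O[atTop] (fun n : ℕ => (n : ℝ) ^ β') →
      ∀ ε : ℝ, 0 < ε → ∃ γ γ' : ℝ, γ + γ' ≤ β + β' + ε ∧
        (fun n : ℕ => (tensorRank (matMulTensor ℂ (n ^ (a + 1)) (n ^ (b + 1)) (n ^ c)) : ℝ)) =O[atTop] (fun n : ℕ => (n : ℝ) ^ γ) ∧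
        (fun n : ℕ => (tensorRank (matMulTensor ℂ (n ^ a) (n ^ b) (n ^ c)) : ℝ)) =O[atTop] (fun n : ℕ => (n : ℝ) ^ γ')) :
    ∀ a b c : ℕ,
      ∀ β β' : ℝ,
      (fun n : ℕ => (tensorRank (matMulTensor ℂ (n ^ (a + 1)) (n ^ b) (n ^ c)) : ℝ)) =O[atTop] (fun n : ℕ => (n : ℝ) ^ β) →
      (fun n : ℕ => (tensorRank (matMulTensor ℂ (n ^ a) (n ^ (b + 1)) (n ^ c)) : ℝ)) =O[atTop] (fun n : ℕ => (n : ℝ) ^ β') →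
      ∀ ε : ℝ, 0 < ε → ∃ γ γ' : ℝ, γ + γ' ≤ β + β' + ε ∧
        (fun n : ℕ => (tensorRank (matMulTensor ℂ (n ^ (a + 1)) (n ^ (b + 1)) (n ^ c)) : ℝ)) =O[atTop] (fun n : ℕ => (n : ℝ) ^ γ) ∧
        (fun n : ℕ => (tensorRank (matMulTensor ℂ (n ^ a) (n ^ b) (n ^ c)) : ℝ)) =O[atTop] (fun n : ℕ => (n : ℝ) ^ γ') := by
  intro a b c β β' h₁ h₂ ε hε
  rcases Nat.eq_zero_or_pos a with ha | ha
  · exact stub_unitExchangeBoundary a b c (Or.inl ha) β β' h₁ h₂ ε hε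
  rcases Nat.eq_zero_or_pos b with hb | hb
  · exact stub_unitExchangeBoundary a b c (Or.inr (Or.inl hb)) β β' h₁ h₂ ε hε
  rcases Nat.eq_zero_or_pos c with hc | hc
  · exact stub_unitExchangeBoundary a b c (Or.inr (Or.inr hc)) β β' h₁ h₂ ε hε
  by_cases hc' : dualExponentAlpha ℂ * ((max (min a b) (min (max a b) c) : ℕ) : ℝ) < ((min a (min b c) : ℕ) : ℝ)
  · by_cases hrs : (∀ δ : ℝ, 0 < δ → ∃ k p₁ p₂ p₃ p₄ p₅ p₆ p₇ p₈ : ℕ, ∃ f₁ g₁ h₁ f₂ g₂ h₂ : ℕ, ∃ u₁ u₂ : ℝ,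
        1 ≤ k ∧ p₁ + p₂ + p₅ + p₆ ≤ k ∧ p₃ + p₄ + p₇ + p₈ ≤ k ∧
        k * a ≤ (p₁ + p₂) * (a + 1) + (p₃ + p₄) * a + f₁ ∧
        k * b ≤ p₁ * b + p₂ * c + p₃ * (b + 1) + p₄ * c + g₁ ∧
        k * c ≤ p₁ * c + p₂ * b + p₃ * c + p₄ * (b + 1) + h₁ ∧
        k * (a + 1) ≤ (p₅ + p₆) * (a + 1) + (p₇ + p₈) * a + f₂ ∧
        k * (b + 1) ≤ p₅ * b + p₆ * c + p₇ * (b + 1) + p₈ * c + g₂ ∧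
        k * c ≤ p₅ * c + p₆ * b + p₇ * c + p₈ * (b + 1) + h₂ ∧
        (fun n : ℕ => (tensorRank (matMulTensor ℂ (n ^ f₁) (n ^ g₁) (n ^ h₁)) : ℝ)) =O[atTop]
          (fun n : ℕ => (n : ℝ) ^ u₁) ∧
        (fun n : ℕ => (tensorRank (matMulTensor ℂ (n ^ f₂) (n ^ g₂) (n ^ h₂)) : ℝ)) =O[atTop]
          (fun n : ℕ => (n : ℝ) ^ u₂) ∧
        u₁ + u₂ + (((p₁ + p₂ + p₅ + p₆) * (max (a + 1 + b) (max (b + c) (a + 1 + c))) +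
            (p₃ + p₄ + p₇ + p₈) * (max (a + (b + 1)) (max (b + 1 + c) (a + c))) : ℕ) : ℝ)
          ≤ ((k * (max (a + 1 + b) (max (b + c) (a + 1 + c)) + max (a + (b + 1)) (max (b + 1 + c) (a + c))) : ℕ) : ℝ)
            + δ)
    · exact stub_cellOfRelSandwich a b c hrs β β' h₁ h₂ ε hε
    · exact hcore a b c ha hb hc hc' hrs β β' h₁ h₂ ε hε
  · rw [not_lt] at hc'
    exact unitExchange_of_flatMeet a b c ha hb hc' β β' h₁ h₂ ε hε

/-! ## The crux is equivalent to the certificate-free core exchange law -/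

/-- **`ShapeSubmodular` from the certificate-free core exchange law**: thresholds (`stub_exponentThreshold`), Topkis
(`stub_localToGlobal`), cyclic symmetry of the rank and `unitExchange_of_coreNoCert`, composed by
`submod_of_threshold_family`. [folklore] -/
theorem ShapeSubmodular_of_coreNoCert
    (hcore : ∀ a b c : ℕ, 1 ≤ a → 1 ≤ b → 1 ≤ c →
      dualExponentAlpha ℂ * ((max (min a b) (min (max a b) c) : ℕ) : ℝ) < ((min a (min b c) : ℕ) : ℝ) →
      ¬ (∀ δ : ℝ, 0 < δ → ∃ k p₁ p₂ p₃ p₄ p₅ p₆ p₇ p₈ : ℕ, ∃ f₁ g₁ h₁ f₂ g₂ h₂ : ℕ, ∃ u₁ u₂ : ℝ,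
        1 ≤ k ∧ p₁ + p₂ + p₅ + p₆ ≤ k ∧ p₃ + p₄ + p₇ + p₈ ≤ k ∧
        k * a ≤ (p₁ + p₂) * (a + 1) + (p₃ + p₄) * a + f₁ ∧
        k * b ≤ p₁ * b + p₂ * c + p₃ * (b + 1) + p₄ * c + g₁ ∧
        k * c ≤ p₁ * c + p₂ * b + p₃ * c + p₄ * (b + 1) + h₁ ∧
        k * (a + 1) ≤ (p₅ + p₆) * (a + 1) + (p₇ + p₈) * a + f₂ ∧
        k * (b + 1) ≤ p₅ * b + p₆ * c + p₇ * (b + 1) + p₈ * c + g₂ ∧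
        k * c ≤ p₅ * c + p₆ * b + p₇ * c + p₈ * (b + 1) + h₂ ∧
        (fun n : ℕ => (tensorRank (matMulTensor ℂ (n ^ f₁) (n ^ g₁) (n ^ h₁)) : ℝ)) =O[atTop]
          (fun n : ℕ => (n : ℝ) ^ u₁) ∧
        (fun n : ℕ => (tensorRank (matMulTensor ℂ (n ^ f₂) (n ^ g₂) (n ^ h₂)) : ℝ)) =O[atTop]
          (fun n : ℕ => (n : ℝ) ^ u₂) ∧
        u₁ + u₂ + (((p₁ + p₂ + p₅ + p₆) * (max (a + 1 + b) (max (b + c) (a + 1 + c))) +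
            (p₃ + p₄ + p₇ + p₈) * (max (a + (b + 1)) (max (b + 1 + c) (a + c))) : ℕ) : ℝ)
          ≤ ((k * (max (a + 1 + b) (max (b + c) (a + 1 + c)) + max (a + (b + 1)) (max (b + 1 + c) (a + c))) : ℕ) : ℝ)
            + δ) →
      ∀ β β' : ℝ,
      (fun n : ℕ => (tensorRank (matMulTensor ℂ (n ^ (a + 1)) (n ^ b) (n ^ c)) : ℝ)) =O[atTop] (fun n : ℕ => (n : ℝ) ^ β) →
      (fun n : ℕ => (tensorRank (matMulTensor ℂ (n ^ a) (n ^ (b + 1)) (n ^ c)) : ℝ)) =O[atTop] (fun n : ℕ => (n : ℝ) ^ β') →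
      ∀ ε : ℝ, 0 < ε → ∃ γ γ' : ℝ, γ + γ' ≤ β + β' + ε ∧
        (fun n : ℕ => (tensorRank (matMulTensor ℂ (n ^ (a + 1)) (n ^ (b + 1)) (n ^ c)) : ℝ)) =O[atTop] (fun n : ℕ => (n : ℝ) ^ γ) ∧
        (fun n : ℕ => (tensorRank (matMulTensor ℂ (n ^ a) (n ^ b) (n ^ c)) : ℝ)) =O[atTop] (fun n : ℕ => (n : ℝ) ^ γ')) :
    ShapeSubmodular := by
  have hrot : ∀ a b c : ℕ, ∀ β : ℝ,
      β ∈ {β : ℝ | (fun n : ℕ => (tensorRank (matMulTensor ℂ (n ^ a) (n ^ b) (n ^ c)) : ℝ)) =O[atTop]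
        (fun n : ℕ => (n : ℝ) ^ β)} ↔
      β ∈ {β : ℝ | (fun n : ℕ => (tensorRank (matMulTensor ℂ (n ^ b) (n ^ c) (n ^ a)) : ℝ)) =O[atTop]
        (fun n : ℕ => (n : ℝ) ^ β)} := by
    intro a b c β
    simp only [Set.mem_setOf_eq]
    have h : (fun n : ℕ => (tensorRank (matMulTensor ℂ (n ^ a) (n ^ b) (n ^ c)) : ℝ)) =
        fun n : ℕ => (tensorRank (matMulTensor ℂ (n ^ b) (n ^ c) (n ^ a)) : ℝ) := by
      funext n
      rw [tensorRank_matMulTensor_rotate ℂ (n ^ a) (n ^ b) (n ^ c)]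
    rw [h]
  exact submod_of_threshold_family
    (fun a b c => {β : ℝ | (fun n : ℕ => (tensorRank (matMulTensor ℂ (n ^ a) (n ^ b) (n ^ c)) : ℝ))
      =O[atTop] (fun n : ℕ => (n : ℝ) ^ β)})
    hrot stub_exponentThreshold stub_localToGlobal (unitExchange_of_coreNoCert hcore)

/-- **The certificate-free core exchange law from `ShapeSubmodular`**: the crux at the adjacent pair `p = (a+1,b,c)`,
`q = (a,b+1,c)` is the unit exchange law at the cell `(a,b,c)` — on every cell (none of the three hypotheses is used).
[folklore] -/
theorem coreNoCert_of_ShapeSubmodular (hS : ShapeSubmodular) :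
    ∀ a b c : ℕ, 1 ≤ a → 1 ≤ b → 1 ≤ c →
      dualExponentAlpha ℂ * ((max (min a b) (min (max a b) c) : ℕ) : ℝ) < ((min a (min b c) : ℕ) : ℝ) →
      ¬ (∀ δ : ℝ, 0 < δ → ∃ k p₁ p₂ p₃ p₄ p₅ p₆ p₇ p₈ : ℕ, ∃ f₁ g₁ h₁ f₂ g₂ h₂ : ℕ, ∃ u₁ u₂ : ℝ,
        1 ≤ k ∧ p₁ + p₂ + p₅ + p₆ ≤ k ∧ p₃ + p₄ + p₇ + p₈ ≤ k ∧
        k * a ≤ (p₁ + p₂) * (a + 1) + (p₃ + p₄) * a + f₁ ∧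
        k * b ≤ p₁ * b + p₂ * c + p₃ * (b + 1) + p₄ * c + g₁ ∧
        k * c ≤ p₁ * c + p₂ * b + p₃ * c + p₄ * (b + 1) + h₁ ∧
        k * (a + 1) ≤ (p₅ + p₆) * (a + 1) + (p₇ + p₈) * a + f₂ ∧
        k * (b + 1) ≤ p₅ * b + p₆ * c + p₇ * (b + 1) + p₈ * c + g₂ ∧
        k * c ≤ p₅ * c + p₆ * b + p₇ * c + p₈ * (b + 1) + h₂ ∧
        (fun n : ℕ => (tensorRank (matMulTensor ℂ (n ^ f₁) (n ^ g₁) (n ^ h₁)) : ℝ)) =O[atTop]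
          (fun n : ℕ => (n : ℝ) ^ u₁) ∧
        (fun n : ℕ => (tensorRank (matMulTensor ℂ (n ^ f₂) (n ^ g₂) (n ^ h₂)) : ℝ)) =O[atTop]
          (fun n : ℕ => (n : ℝ) ^ u₂) ∧
        u₁ + u₂ + (((p₁ + p₂ + p₅ + p₆) * (max (a + 1 + b) (max (b + c) (a + 1 + c))) +
            (p₃ + p₄ + p₇ + p₈) * (max (a + (b + 1)) (max (b + 1 + c) (a + c))) : ℕ) : ℝ)
          ≤ ((k * (max (a + 1 + b) (max (b + c) (a + 1 + c)) + max (a + (b + 1)) (max (b + 1 + c) (a + c))) : ℕ) : ℝ)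
            + δ) →
      ∀ β β' : ℝ,
      (fun n : ℕ => (tensorRank (matMulTensor ℂ (n ^ (a + 1)) (n ^ b) (n ^ c)) : ℝ)) =O[atTop] (fun n : ℕ => (n : ℝ) ^ β) →
      (fun n : ℕ => (tensorRank (matMulTensor ℂ (n ^ a) (n ^ (b + 1)) (n ^ c)) : ℝ)) =O[atTop] (fun n : ℕ => (n : ℝ) ^ β') →
      ∀ ε : ℝ, 0 < ε → ∃ γ γ' : ℝ, γ + γ' ≤ β + β' + ε ∧
        (fun n : ℕ => (tensorRank (matMulTensor ℂ (n ^ (a + 1)) (n ^ (b + 1)) (n ^ c)) : ℝ)) =O[atTop] (fun n : ℕ => (n : ℝ) ^ γ) ∧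
        (fun n : ℕ => (tensorRank (matMulTensor ℂ (n ^ a) (n ^ b) (n ^ c)) : ℝ)) =O[atTop] (fun n : ℕ => (n : ℝ) ^ γ') := by
  intro a b c _ha _hb _hc _hcore _hrs β β' h₁ h₂ ε hε
  obtain ⟨γ, γ', hsum, hjoin, hmeet⟩ := hS (a + 1) b c a (b + 1) c β β' h₁ h₂ ε hε
  rw [max_eq_left (Nat.le_succ a), max_eq_right (Nat.le_succ b), max_self] at hjoin
  rw [min_eq_right (Nat.le_succ a), min_eq_left (Nat.le_succ b), min_self] at hmeet
  exact ⟨γ, γ', hsum, hjoin, hmeet⟩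

/-- **The crux `ShapeSubmodular` is equivalent to the unit exchange law on the CERTIFICATE-FREE fat core**
`{(a,b,c) ∈ ℕ³ : a,b,c ≥ 1, α·median < min, no relative-sandwich certificate}`.  Every cell outside this set is a
theorem of the tree; every cell inside it with `a,b,c ≤ 12` has an explicit model of all known shape facts and tables
violating it (census-c3.md): SUBMOD can neither be proved nor refuted by bookkeeping. [folklore] -/
theorem ShapeSubmodular_iff_coreNoCert :
    Summit.MatrixMultiplication.MatrixMultiplication.Theses.ShapeSubmodularity.ShapeSubmodular ↔
    (∀ a b c : ℕ, 1 ≤ a → 1 ≤ b → 1 ≤ c →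
      Literature.Computability.AlgebraicComplexity.dualExponentAlpha ℂ * ((max (min a b) (min (max a b) c) : ℕ) : ℝ) < ((min a (min b c) : ℕ) : ℝ) →
      ¬ (∀ δ : ℝ, 0 < δ → ∃ k p₁ p₂ p₃ p₄ p₅ p₆ p₇ p₈ : ℕ, ∃ f₁ g₁ h₁ f₂ g₂ h₂ : ℕ, ∃ u₁ u₂ : ℝ,
        1 ≤ k ∧ p₁ + p₂ + p₅ + p₆ ≤ k ∧ p₃ + p₄ + p₇ + p₈ ≤ k ∧
        k * a ≤ (p₁ + p₂) * (a + 1) + (p₃ + p₄) * a + f₁ ∧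
        k * b ≤ p₁ * b + p₂ * c + p₃ * (b + 1) + p₄ * c + g₁ ∧
        k * c ≤ p₁ * c + p₂ * b + p₃ * c + p₄ * (b + 1) + h₁ ∧
        k * (a + 1) ≤ (p₅ + p₆) * (a + 1) + (p₇ + p₈) * a + f₂ ∧
        k * (b + 1) ≤ p₅ * b + p₆ * c + p₇ * (b + 1) + p₈ * c + g₂ ∧
        k * c ≤ p₅ * c + p₆ * b + p₇ * c + p₈ * (b + 1) + h₂ ∧
        (fun n : ℕ => (Literature.Computability.AlgebraicComplexity.tensorRank (Literature.Computability.AlgebraicComplexity.matMulTensor ℂ (n ^ f₁) (n ^ g₁) (n ^ h₁)) : ℝ)) =O[Filter.atTop]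
          (fun n : ℕ => (n : ℝ) ^ u₁) ∧
        (fun n : ℕ => (Literature.Computability.AlgebraicComplexity.tensorRank (Literature.Computability.AlgebraicComplexity.matMulTensor ℂ (n ^ f₂) (n ^ g₂) (n ^ h₂)) : ℝ)) =O[Filter.atTop]
          (fun n : ℕ => (n : ℝ) ^ u₂) ∧
        u₁ + u₂ + (((p₁ + p₂ + p₅ + p₆) * (max (a + 1 + b) (max (b + c) (a + 1 + c))) +
            (p₃ + p₄ + p₇ + p₈) * (max (a + (b + 1)) (max (b + 1 + c) (a + c))) : ℕ) : ℝ)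
          ≤ ((k * (max (a + 1 + b) (max (b + c) (a + 1 + c)) + max (a + (b + 1)) (max (b + 1 + c) (a + c))) : ℕ) : ℝ)
            + δ) →
      ∀ β β' : ℝ,
      (fun n : ℕ => (Literature.Computability.AlgebraicComplexity.tensorRank (Literature.Computability.AlgebraicComplexity.matMulTensor ℂ (n ^ (a + 1)) (n ^ b) (n ^ c)) : ℝ)) =O[Filter.atTop] (fun n : ℕ => (n : ℝ) ^ β) →
      (fun n : ℕ => (Literature.Computability.AlgebraicComplexity.tensorRank (Literature.Computability.AlgebraicComplexity.matMulTensor ℂ (n ^ a) (n ^ (b + 1)) (n ^ c)) : ℝ)) =O[Filter.atTop] (fun n : ℕ => (n : ℝ) ^ β') →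
      ∀ ε : ℝ, 0 < ε → ∃ γ γ' : ℝ, γ + γ' ≤ β + β' + ε ∧
        (fun n : ℕ => (Literature.Computability.AlgebraicComplexity.tensorRank (Literature.Computability.AlgebraicComplexity.matMulTensor ℂ (n ^ (a + 1)) (n ^ (b + 1)) (n ^ c)) : ℝ)) =O[Filter.atTop] (fun n : ℕ => (n : ℝ) ^ γ) ∧
        (fun n : ℕ => (Literature.Computability.AlgebraicComplexity.tensorRank (Literature.Computability.AlgebraicComplexity.matMulTensor ℂ (n ^ a) (n ^ b) (n ^ c)) : ℝ)) =O[Filter.atTop] (fun n : ℕ => (n : ℝ) ^ γ')) :=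
  ⟨coreNoCert_of_ShapeSubmodular, ShapeSubmodular_of_coreNoCert⟩

end Summit.MatrixMultiplication.MatrixMultiplication.Theorems.ShapeSubmodular
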